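import Literature.AlgebraicGeometry.Smoothening.ProjectiveModelCharts
import Literature.AlgebraicGeometry.Motives.ZariskiChowCover
import Mathlib.AlgebraicGeometry.Morphisms.Smooth
import Mathlib.RingTheory.Localization.BaseChange
import HarnessLib

/-!
# The generic fibres of the charts of a projective model (BLR 3.5: inputs of the smoothening)

Topic: `Literature/AlgebraicGeometry/Smoothening` (Bosch–Lütkebohmert–Raynaud, *Néron Models*,
§3.3–3.5: the smoothening process is applied to an `R`-model `X` of finite type whose generic
fibre `X_K` is smooth; for an abelian variety the model is projective and each affine chart
`Xₛ = Spec (R[y]/Iₛ)` has generic fibre an open subscheme of `X_K`). For a projective model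
`P` of a `K`-scheme `E` (`ProjectiveModel`, `ProjectiveModelCharts`) and its chart
`Spec Aₛ → P`, `Aₛ = R[y₁, …, yₙ]/Iₛ`:

* `genChart`, `isPullback_genChart` — the base change `Spec Aₛ ×_R Spec K → E` of the chart along
  `E = P ×_R Spec K → P` is an open immersion; `genPieceIso` — its source is
  `Spec (Aₛ ⊗_R K)` (Mathlib `pullbackSpecIso`); `genChartSpec : Spec (Aₛ ⊗_R K) → E`, an open
  immersion over `Spec K` (`genChartSpec_hom`);
* `isDomain_or_subsingleton` — if `E` is integral then `Aₛ ⊗_R K` is a domain or zero;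
* for `R` a discrete valuation ring with uniformizer `ϖ` (`K = R[1/ϖ]`,
  `Motives.ZariskiChow.isLocalizationAway_of_irreducible`): `isLocalization_away_tensor` —
  `Aₛ ⊗_R K = Aₛ[1/ϖ]`; `smooth_tensor` — if `E → Spec K` is smooth then `Aₛ ⊗_R K` is a smooth
  `R`-algebra (`Spec (Aₛ ⊗_R K) → E → Spec K → Spec R`, the last map an open immersion), hence
  (`formallySmooth_away`, transported along `tensorAlgEquivAway : Aₛ ⊗_R K ≃ Aₛ[1/ϖ]`)
  `Ω[Aₛ[1/ϖ]⁄R]` is projective and `Aₛ` is smooth over `R` at the primes of the generic fibre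
  (`GenericFibreSmooth`) — the hypotheses of `Forest.nonempty_smoothening_of_projective` and of
  `DefectZeroSmooth`; `isDomain_or_subsingleton_away`.

[folklore]; no named facts (D-0026).

## References

* S. Bosch, W. Lütkebohmert, M. Raynaud, *Néron Models*, Springer 1990, §3.3, §3.5.
  [BLRNeronModels1990] (Not held; numbers only.)
-/

noncomputable section

open CategoryTheory CategoryTheory.Limits AlgebraicGeometry
open scoped TensorProduct
open Literature.AlgebraicGeometry.Motives

namespace Literature.AlgebraicGeometry.Smoothening

namespace ProjectiveModel

universe u

variable {R K : Type u} [CommRing R] [Field K] [Algebra R K] {E : SchemeOver K}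
  (M : ProjectiveModel R K E) (s : Fin (M.n + 1))

/-- The ring `Aₛ = R[y₁, …, yₙ]/Iₛ` of the `s`-th chart. [folklore] -/
abbrev chartRing : Type u := MvPolynomial (Fin M.n) R ⧸ M.chartIdeal s

/-- The generic fibre `Spec Aₛ ×_R Spec K` of the `s`-th chart. [folklore] -/
abbrev genPiece : Scheme.{u} :=
  pullback (M.chart s ≫ M.hom) (Spec.map (CommRingCat.ofHom (algebraMap R K)))

/-- **The generic fibre of the chart maps to `E`**: the morphism `Spec Aₛ ×_R Spec K → E`
induced by `E = P ×_R Spec K`. [folklore] -/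
def genChart : M.genPiece s ⟶ E.left :=
  M.isPullback.lift (pullback.fst _ _ ≫ M.chart s) (pullback.snd _ _)
    (by rw [Category.assoc, pullback.condition])

/-- `Spec Aₛ ×_R Spec K → E → P` is the projection followed by the chart. [folklore] -/
@[reassoc]
theorem genChart_gen : M.genChart s ≫ M.gen = pullback.fst _ _ ≫ M.chart s :=
  M.isPullback.lift_fst _ _ _

/-- `Spec Aₛ ×_R Spec K → E → Spec K` is the projection. [folklore] -/
@[reassoc]
theorem genChart_hom : M.genChart s ≫ E.hom = pullback.snd _ _ :=
  M.isPullback.lift_snd _ _ _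

/-- The square `Spec Aₛ ×_R Spec K → E`, `Spec Aₛ → P` is cartesian. [folklore] -/
theorem isPullback_genChart :
    IsPullback (M.genChart s) (pullback.fst (M.chart s ≫ M.hom) _) M.gen (M.chart s) := by
  refine IsPullback.of_right ?_ (M.genChart_gen s) M.isPullback.flip
  rw [genChart_hom]
  exact (IsPullback.of_hasPullback _ _).flip

/-- `Spec Aₛ ×_R Spec K → E` is an open immersion (base change of the chart). [folklore] -/
instance isOpenImmersion_genChart : IsOpenImmersion (M.genChart s) :=
  MorphismProperty.of_isPullback (M.isPullback_genChart s).flip inferInstance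

/-- `Spec Aₛ ×_R Spec K ≅ Spec (Aₛ ⊗_R K)` (Mathlib `pullbackSpecIso`). [folklore] -/
def genPieceIso : M.genPiece s ≅ Spec (.of (M.chartRing s ⊗[R] K)) :=
  pullback.congrHom (M.chart_hom s) rfl ≪≫ pullbackSpecIso R (M.chartRing s) K

/-- The first projection on `Spec (Aₛ ⊗_R K)` is `Spec` of `a ↦ a ⊗ 1`. [folklore] -/
@[reassoc]
theorem genPieceIso_inv_fst : (M.genPieceIso s).inv ≫ pullback.fst _ _ =
    Spec.map (CommRingCat.ofHom (Algebra.TensorProduct.includeLeftRingHom)) := by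
  rw [genPieceIso, Iso.trans_inv, Category.assoc, pullback.congrHom_inv, pullback.lift_fst,
    Category.comp_id, pullbackSpecIso_inv_fst]

/-- The second projection on `Spec (Aₛ ⊗_R K)` is `Spec` of `c ↦ 1 ⊗ c`. [folklore] -/
@[reassoc]
theorem genPieceIso_inv_snd : (M.genPieceIso s).inv ≫ pullback.snd _ _ =
    Spec.map (CommRingCat.ofHom (Algebra.TensorProduct.includeRight (R := R) (A := M.chartRing s)
      (B := K)).toRingHom) := by
  rw [genPieceIso, Iso.trans_inv, Category.assoc, pullback.congrHom_inv, pullback.lift_snd,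
    Category.comp_id, pullbackSpecIso_inv_snd]
  rfl

/-- **The generic fibre of the `s`-th chart as an open subscheme of `E`**:
`Spec (Aₛ ⊗_R K) → E`, an open immersion. [folklore] -/
def genChartSpec : Spec (.of (M.chartRing s ⊗[R] K)) ⟶ E.left :=
  (M.genPieceIso s).inv ≫ M.genChart s

/-- `Spec (Aₛ ⊗_R K) → E` is an open immersion. [folklore] -/
instance isOpenImmersion_genChartSpec : IsOpenImmersion (M.genChartSpec s) := by
  unfold genChartSpec; infer_instance

/-- It lies over `Spec K` through `K → Aₛ ⊗_R K`, `c ↦ 1 ⊗ c`. [folklore] -/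
@[reassoc]
theorem genChartSpec_hom : M.genChartSpec s ≫ E.hom =
    Spec.map (CommRingCat.ofHom (Algebra.TensorProduct.includeRight (R := R) (A := M.chartRing s)
      (B := K)).toRingHom) := by
  rw [genChartSpec, Category.assoc, genChart_hom, genPieceIso_inv_snd]

/-- It lifts the chart: `Spec (Aₛ ⊗_R K) → E → P` is `Spec (Aₛ ⊗_R K) → Spec Aₛ → P`. [folklore] -/
theorem genChartSpec_gen : M.genChartSpec s ≫ M.gen =
    Spec.map (CommRingCat.ofHom (Algebra.TensorProduct.includeLeftRingHom)) ≫ M.chart s := by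
  rw [genChartSpec, Category.assoc, genChart_gen, genPieceIso_inv_fst_assoc]

/-- Over `Spec R`: `Spec (Aₛ ⊗_R K) → E → Spec K → Spec R` is `Spec` of `R → Aₛ ⊗_R K`. [folklore] -/
theorem genChartSpec_hom_specMap : M.genChartSpec s ≫ E.hom ≫ Spec.map (CommRingCat.ofHom (algebraMap R K)) =
    Spec.map (CommRingCat.ofHom (algebraMap R (M.chartRing s ⊗[R] K))) := by
  rw [M.genChartSpec_hom_assoc s, ← Spec.map_comp, ← CommRingCat.ofHom_comp]
  congr 2
  refine RingHom.ext fun r => ?_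
  exact (Algebra.TensorProduct.includeRight (R := R) (A := M.chartRing s) (B := K)).commutes r

/-! ### Integrality -/

/-- **If `E` is integral, the generic fibre ring `Aₛ ⊗_R K` of every chart is a domain or zero**
(an open subscheme of an integral scheme is integral or empty). [folklore] -/
theorem isDomain_or_subsingleton [IsIntegral E.left] :
    IsDomain (M.chartRing s ⊗[R] K) ∨ Subsingleton (M.chartRing s ⊗[R] K) := by
  by_cases h : Nontrivial (M.chartRing s ⊗[R] K)
  · left
    haveI := h
    haveI : IsIntegral (Spec (.of (M.chartRing s ⊗[R] K))) :=
      isIntegral_of_isOpenImmersion (M.genChartSpec s)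
    exact (affine_isIntegral_iff _).mp this
  · right
    exact not_nontrivial_iff_subsingleton.mp h

/-! ### Over a discrete valuation ring -/

section DVR

variable [IsDomain R] [IsDiscreteValuationRing R] [IsFractionRing R K]

/-- **`Aₛ ⊗_R K = Aₛ[1/ϖ]`** for a uniformizer `ϖ` of the discrete valuation ring `R`
(`K = R[1/ϖ]` and localisation commutes with base change). [folklore] -/
theorem isLocalization_away_tensor {ϖ : R} (hϖ : Irreducible ϖ) :
    IsLocalization.Away (algebraMap R (M.chartRing s) ϖ) (M.chartRing s ⊗[R] K) := by
  haveI := ZariskiChow.isLocalizationAway_of_irreducible R K hϖ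
  have h := IsLocalization.tensor (R := R) (S := M.chartRing s) K (Submonoid.powers ϖ)
  rwa [Algebra.algebraMapSubmonoid_powers] at h

/-- **If `E → Spec K` is smooth then `Aₛ ⊗_R K` is a smooth `R`-algebra**:
`Spec (Aₛ ⊗_R K) → E → Spec K → Spec R` is smooth, the last map being an open immersion for a
discrete valuation ring. [folklore] -/
theorem smooth_tensor [Smooth E.hom] : Algebra.Smooth R (M.chartRing s ⊗[R] K) := by
  haveI : IsOpenImmersion (Spec.map (CommRingCat.ofHom (algebraMap R K))) :=
    ZariskiChow.isOpenImmersion_specMap_algebraMap R K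
  have h : Smooth (Spec.map (CommRingCat.ofHom (algebraMap R (M.chartRing s ⊗[R] K)))) := by
    rw [← genChartSpec_hom_specMap]
    infer_instance
  rw [HasRingHomProperty.Spec_iff (P := @Smooth)] at h
  exact RingHom.smooth_algebraMap.mp h

/-- The two realisations `Aₛ ⊗_R K` and `Aₛ[1/ϖ]` (Mathlib `Localization.Away`) of the generic
fibre ring are isomorphic `Aₛ`-algebras. [folklore] -/
def tensorAlgEquivAway {ϖ : R} (hϖ : Irreducible ϖ) :
    (M.chartRing s ⊗[R] K) ≃ₐ[M.chartRing s] Localization.Away (algebraMap R (M.chartRing s) ϖ) :=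
  haveI := M.isLocalization_away_tensor s hϖ
  IsLocalization.algEquiv (Submonoid.powers (algebraMap R (M.chartRing s) ϖ))
    (M.chartRing s ⊗[R] K) (Localization.Away (algebraMap R (M.chartRing s) ϖ))

/-- **If `E → Spec K` is smooth then `Aₛ[1/ϖ]` is formally smooth over `R`** (so `Ω[Aₛ[1/ϖ]⁄R]` is
projective, Mathlib `Algebra.FormallySmooth.projective_kaehlerDifferential`: the hypothesis of
`Forest.nonempty_smoothening_of_projective` and of `GenericFibreSmooth`). Stated for Mathlib's
`Localization.Away`, transported from `Aₛ ⊗_R K` (`smooth_tensor`). [folklore] -/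
theorem formallySmooth_away [Smooth E.hom] {ϖ : R} (hϖ : Irreducible ϖ) :
    Algebra.FormallySmooth R (Localization.Away (algebraMap R (M.chartRing s) ϖ)) := by
  haveI := M.smooth_tensor s
  exact Algebra.FormallySmooth.of_equiv (A := M.chartRing s ⊗[R] K)
    ((M.tensorAlgEquivAway s hϖ).restrictScalars R)

/-- **If `E` is integral then `Aₛ[1/ϖ]` is a domain or zero.** [folklore] -/
theorem isDomain_or_subsingleton_away [IsIntegral E.left] {ϖ : R} (hϖ : Irreducible ϖ) :
    IsDomain (Localization.Away (algebraMap R (M.chartRing s) ϖ)) ∨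
      Subsingleton (Localization.Away (algebraMap R (M.chartRing s) ϖ)) := by
  rcases M.isDomain_or_subsingleton s with h | h
  · exact Or.inl ((M.tensorAlgEquivAway s hϖ).toMulEquiv.isDomain_iff.mp h)
  · exact Or.inr (M.tensorAlgEquivAway s hϖ).symm.toEquiv.subsingleton

end DVR

end ProjectiveModel

end Literature.AlgebraicGeometry.Smoothening

end
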